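import Literature.AlgebraicGeometry.ShimuraVarieties.UnitaryBallPeterssonRecord
import Literature.AlgebraicGeometry.ShimuraVarieties.UnitaryBallDiscontinuity
import Literature.NumberTheory.Automorphic.LevelOrbitPushforward
import Literature.MeasureTheory.Group.DiscreteSubgroupDomain
import Literature.Geometry.ComplexHyperbolic.UnitBallMeasure
import Literature.MeasureTheory.Integral.NormSqPolarisation
import HarnessLib

/-!
# Descent of Baily's group integral: `PeterssonWedgeFormula` from the record and the ball formula

KERNEL discharge (registry node N-D2, stage 2) of the open junction hypothesis
`UnitaryBallUniformisationDatum.PeterssonWedgeFormula` (`UnitaryBallPeterssonRecord`) from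

* Baily's record `BallForms.Baily1973_10_3 μ` (`∫_G |′f|² dg = c ∫_𝔹 |f|² dv`,
  `UnitaryBallGroupIntegralRecord`), and
* the ball-side formula `UnitaryBallUniformisationDatum.BallWedgeFormula`
  (`∫_{𝓕_D} F_α conj F_α′ dv = c₄ ∫_X α ∧ ᾱ′`, discharged elsewhere in the package),

for `Δ = ρ_𝔣(Γ)` discrete and cocompact in `U(2,1)`:
`PeterssonWedgeFormula_of : Baily1973_10_3 μ → BallWedgeFormula → PeterssonWedgeFormula μ`.

## Proof

1. **Polarisation** (`Literature.MeasureTheory.Integral.integral_conj_mul_eq_of_sq`,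
   file `NormSqPolarisation`): an `ℝ`-homogeneous additive map `T`
   with `∫ ‖T f‖² dμ = c ∫ ‖f‖² dν` for all measurable `f` satisfies
   `∫ conj (T g) · T f dμ = c ∫ conj g · f dν` for measurable square-integrable `f, g`
   (`conj b · a = ¼ Σ_{ε ∈ {±1, ±i}} ε̄ ‖a + ε b‖²`, integrated).
2. **Null sets and fundamental domains transfer along the orbit map** `π : g ↦ g · x₀`
   (`measure_orbitPre_null`, `isFundamentalDomain_orbitPre`): the record applied to indicator
   functions (`|′1_N|² = 1_{π⁻¹N} |j(·,x₀)|²`, `j ≠ 0`) shows `v(N) = 0 ⇒ μ(π⁻¹N) = 0`, whence the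
   preimage `π⁻¹𝓕_D` of a measurable fundamental domain `𝓕_D ⊆ 𝔹²` of `Δ` is a (left) fundamental
   domain of `Δ` in `U(2,1)` for the Haar measure `μ`.
3. **A ball fundamental domain exists** (`exists_isFundamentalDomain_ball`): `Γ` acts freely and
   properly discontinuously on `𝔹²` (`UnitaryBallDiscontinuity`), so the library's construction
   `DiscreteSubgroup.exists_subset_measurableSet_existsUnique` applies.
4. **Unfolding**: `′(1_{𝓕_D} F) = 1_{π⁻¹𝓕_D} ′F`, so step 1 with `f = 1_{𝓕_D} F_α`,
   `g = 1_{𝓕_D} F_α′` reads `∫_{π⁻¹𝓕_D} liftPairing 1 F_α′ F_α dμ = c ∫_{𝓕_D} conj F_α′ · F_α dv`;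
   square-integrability comes from the record and the finiteness of `∫_{𝓕} |′F|² dμ` over ONE
   relatively compact fundamental domain (`DiscreteSubgroup.exists_isFundamentalDomain_op_finite`,
   inverted by `LevelOrbit.isFundamentalDomain_inv_of_op`), all fundamental domains giving the same
   integral of the `Δ`-invariant integrand (`IsFundamentalDomain.setLIntegral_eq` /
   `setIntegral_eq`, invariance `liftPairing_holAutForms_mul_left`).
5. Compose with `BallWedgeFormula`: `c_total = c · c₄ ≠ 0`.

No statement of the literature is recorded here (0 records); every declaration is proved.
-/

noncomputable section

open Matrix MulAction Function Set Filter MeasureTheory Complex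
open scoped Topology ComplexConjugate ENNReal NNReal Pointwise
open Literature.Geometry.ComplexHyperbolic
open Literature.Geometry.ComplexHyperbolic.BallModel (U21 Ball x₀ nsq ballVolume)
open Literature.NumberTheory.Automorphic.AutomorphyFactor
open Literature.MeasureTheory.Group
open Literature.MeasureTheory.Integral
open Literature.NumberTheory.Automorphic

namespace Literature.AlgebraicGeometry.ShimuraVarieties

namespace BallForms

/-! ### §1 The orbit map `π : g ↦ g · x₀` and Baily's `′f` on indicator functions -/

/-- `π⁻¹ S = {g ∈ U(2,1) | g · x₀ ∈ S}`. [folklore] -/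
def orbitPre (S : Set Ball) : Set U21 := (fun g : U21 ↦ g • x₀) ⁻¹' S

/-- Membership in `π⁻¹ S`. [folklore] -/
@[simp] theorem mem_orbitPre {S : Set Ball} {g : U21} : g ∈ orbitPre S ↔ g • x₀ ∈ S := Iff.rfl

/-- The orbit map is continuous. [folklore] -/
theorem continuous_orbit : Continuous fun g : U21 ↦ g • x₀ := continuous_id.smul continuous_const

/-- The orbit map is measurable. [folklore] -/
theorem measurable_orbit : Measurable fun g : U21 ↦ g • x₀ := continuous_orbit.measurable

/-- `π⁻¹` of a measurable set is measurable. [folklore] -/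
theorem measurableSet_orbitPre {S : Set Ball} (hS : MeasurableSet S) : MeasurableSet (orbitPre S) :=
  measurable_orbit hS

/-- `π⁻¹` commutes with intersections. [folklore] -/
theorem orbitPre_inter (S T : Set Ball) : orbitPre (S ∩ T) = orbitPre S ∩ orbitPre T := rfl

/-- `π` is `Δ`-equivariant: `δ · π⁻¹ S = π⁻¹ (δ · S)`. [folklore] -/
theorem smul_orbitPre {Δ : Subgroup U21} (δ : Δ) (S : Set Ball) :
    δ • orbitPre S = orbitPre (δ • S) := by
  ext g
  rw [Set.mem_smul_set_iff_inv_smul_mem, mem_orbitPre, mem_orbitPre,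
    Set.mem_smul_set_iff_inv_smul_mem, Subgroup.smul_def, smul_eq_mul, mul_smul,
    BallModel.subgroup_smul_def]

/-- `′(1_S f) = 1_{π⁻¹ S} ′f`. [folklore] -/
theorem primeLift_indicator (l : ℕ) (S : Set Ball) (f : Ball → ℂ) :
    primeLift l (S.indicator f) = (orbitPre S).indicator (primeLift l f) := by
  ext g
  by_cases hg : g • x₀ ∈ S
  · simp [primeLift_apply, hg]
  · simp [primeLift_apply, hg]

/-- `f ↦ ′f` is additive-homogeneous. [folklore] -/
theorem primeLift_add_smul (l : ℕ) (a : ℂ) (f f' : Ball → ℂ) :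
    primeLift l (f + a • f') = primeLift l f + a • primeLift l f' := by
  ext g
  simp only [primeLift_apply, Pi.add_apply, Pi.smul_apply, smul_eq_mul]
  ring

/-- `′f` is measurable for measurable `f`. [folklore] -/
theorem measurable_primeLift (l : ℕ) {f : Ball → ℂ} (hf : Measurable f) :
    Measurable (primeLift l f) := by
  have h : primeLift l f = fun g ↦ canonicalFactor g x₀ ^ l * f (g • x₀) :=
    funext (primeLift_apply l f)
  rw [h]
  exact ((continuous_canonicalFactor x₀).measurable.pow_const l).mul (hf.comp measurable_orbit)

/-- `′f` is continuous for continuous `f`. [folklore] -/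
theorem continuous_primeLift (l : ℕ) {f : Ball → ℂ} (hf : Continuous f) :
    Continuous (primeLift l f) := by
  have h : primeLift l f = fun g ↦ canonicalFactor g x₀ ^ l * f (g • x₀) :=
    funext (primeLift_apply l f)
  rw [h]
  exact ((continuous_canonicalFactor x₀).pow l).mul (hf.comp continuous_orbit)

/-- `conj ′F′ · ′F = liftPairing 1 F′ F` (definitionally). [folklore] -/
theorem conj_primeLift_mul_primeLift (F' F : Ball → ℂ) (g : U21) :
    conj (primeLift 1 F' g) * primeLift 1 F g = liftPairing 1 F' F g := rfl

/-- `|′F|² = liftPairing 1 F F` as a real number: `‖′F u‖² = re (liftPairing 1 F F u)`, in the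
form `((‖′F u‖ ^ 2 : ℝ) : ℂ) = liftPairing 1 F F u`. [folklore] -/
theorem ofReal_norm_primeLift_sq (F : Ball → ℂ) (u : U21) :
    ((‖primeLift 1 F u‖ ^ 2 : ℝ) : ℂ) = liftPairing 1 F F u := by
  rw [← conj_primeLift_mul_primeLift, RCLike.conj_mul]; norm_cast

/-! ### §2 Consequences of the record: null sets and fundamental domains along `π` -/

section Record

variable (μ : Measure U21)

/-- **Null sets pull back along `π`**: if `∫ |′f|² dμ = c ∫ |f|² dv` for all measurable `f`,
then `v(N) = 0 ⇒ μ(π⁻¹ N) = 0` (apply the identity to `f = 1_{N′}`, `N ⊆ N′` measurable null: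
`|′1_{N′}(g)|² = 1_{π⁻¹N′}(g) |j(g,x₀)|²` with `j ≠ 0`). [folklore] -/
theorem measure_orbitPre_null {c : ℝ≥0∞}
    (hR : ∀ f : Ball → ℂ, Measurable f →
      ∫⁻ g, ‖primeLift 1 f g‖ₑ ^ 2 ∂μ = c * ∫⁻ z, ‖f z‖ₑ ^ 2 ∂ballVolume)
    {N : Set Ball} (hN : ballVolume N = 0) : μ (orbitPre N) = 0 := by
  obtain ⟨N', hNN', hN'm, hN'0⟩ := exists_measurable_superset_of_null hN
  refine measure_mono_null (Set.preimage_mono hNN') ?_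
  set f : Ball → ℂ := N'.indicator 1 with hf_def
  have hf : Measurable f := measurable_one.indicator hN'm
  have h0 : ∫⁻ z, ‖f z‖ₑ ^ 2 ∂ballVolume = 0 := by
    have h : ∀ z, ‖f z‖ₑ ^ 2 = N'.indicator 1 z := by
      intro z
      by_cases hz : z ∈ N'
      · simp [hf_def, hz]
      · simp [hf_def, hz]
    simp_rw [h]
    rw [lintegral_indicator_one hN'm, hN'0]
  have h1 := hR f hf
  rw [h0, mul_zero, primeLift_indicator] at h1
  have h2 : ∫⁻ g in orbitPre N', ‖primeLift 1 (1 : Ball → ℂ) g‖ₑ ^ 2 ∂μ = 0 := by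
    rw [← lintegral_indicator (measurableSet_orbitPre hN'm), ← h1]
    refine lintegral_congr fun g ↦ ?_
    by_cases hg : g ∈ orbitPre N'
    · simp [hg]
    · simp [hg]
  have hmeas : Measurable fun g : U21 ↦ ‖primeLift 1 (1 : Ball → ℂ) g‖ₑ ^ 2 :=
    (measurable_primeLift 1 measurable_one).enorm.pow_const 2
  have h3 := (lintegral_eq_zero_iff hmeas).1 h2
  have h4 : ∀ᵐ g ∂(μ.restrict (orbitPre N')), False := h3.mono fun g hg ↦ by
    simp only [primeLift_apply, pow_one, Pi.one_apply, mul_one, Pi.zero_apply] at hg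
    exact absurd hg (by simp [canonicalFactor_ne_zero])
  rwa [Filter.eventually_false_iff_eq_bot, ae_eq_bot, Measure.restrict_eq_zero] at h4

/-- **Fundamental domains pull back along `π`**: if `v`-null sets have `μ`-null preimages, the
preimage `π⁻¹ 𝓕_D` of a measurable fundamental domain `𝓕_D` of `Δ` in the ball is a fundamental
domain of the left translation action of `Δ` on `U(2,1)`. [folklore] -/
theorem isFundamentalDomain_orbitPre {Δ : Subgroup U21} [Countable Δ]
    (hnull : ∀ N : Set Ball, ballVolume N = 0 → μ (orbitPre N) = 0)
    {𝓕D : Set Ball} (hm : MeasurableSet 𝓕D) (h : IsFundamentalDomain Δ 𝓕D ballVolume) :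
    IsFundamentalDomain Δ (orbitPre 𝓕D) μ where
  nullMeasurableSet := (measurableSet_orbitPre hm).nullMeasurableSet
  ae_covers := by
    have h1 := h.ae_covers
    rw [ae_iff] at h1 ⊢
    refine measure_mono_null (fun g hg ↦ ?_) (hnull _ h1)
    simp only [Set.mem_setOf_eq, mem_orbitPre, not_exists] at hg ⊢
    intro δ hδ
    exact hg δ (by rwa [Subgroup.smul_def, smul_eq_mul, mul_smul, ← BallModel.subgroup_smul_def])
  aedisjoint := by
    intro δ δ' hne
    change μ (δ • orbitPre 𝓕D ∩ δ' • orbitPre 𝓕D) = 0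
    rw [smul_orbitPre, smul_orbitPre, ← orbitPre_inter]
    exact hnull _ (h.aedisjoint hne)

/-- **Finiteness**: for `Δ` discrete and cocompact, a continuous `h : U(2,1) → ℂ` with `|h|²`
left `Δ`-invariant has `∫_{𝓕} |h|² dμ < ∞` over every fundamental domain `𝓕` (compare with one
relatively compact fundamental domain). [folklore] -/
theorem setLIntegral_lt_top_of_invariant [μ.IsHaarMeasure] {Δ : Subgroup U21} [Countable Δ]
    [DiscreteTopology Δ] [CompactSpace (U21 ⧸ Δ)]
    {𝓕 : Set U21} (h𝓕 : IsFundamentalDomain Δ 𝓕 μ) {h : U21 → ℂ} (hc : Continuous h)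
    (hinv : ∀ δ ∈ Δ, ∀ u, ‖h (δ * u)‖ₑ ^ 2 = ‖h u‖ₑ ^ 2) :
    ∫⁻ u in 𝓕, ‖h u‖ₑ ^ 2 ∂μ < ⊤ := by
  obtain ⟨𝓕₀, -, h𝓕₀, hK, -⟩ := DiscreteSubgroup.exists_isFundamentalDomain_op_finite Δ μ
  have h𝓕₁ : IsFundamentalDomain Δ 𝓕₀⁻¹ μ := LevelOrbit.isFundamentalDomain_inv_of_op Δ μ h𝓕₀
  rw [h𝓕.setLIntegral_eq h𝓕₁ (fun u ↦ ‖h u‖ₑ ^ 2) fun δ u ↦ by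
    rw [Subgroup.smul_def, smul_eq_mul]; exact hinv δ δ.2 u]
  obtain ⟨C, hC⟩ := hK.inv.exists_bound_of_continuousOn hc.continuousOn
  calc ∫⁻ u in 𝓕₀⁻¹, ‖h u‖ₑ ^ 2 ∂μ
      ≤ ∫⁻ u in (closure 𝓕₀)⁻¹, ‖h u‖ₑ ^ 2 ∂μ :=
        lintegral_mono_set (Set.inv_subset_inv.2 subset_closure)
    _ ≤ ∫⁻ _ in (closure 𝓕₀)⁻¹, ENNReal.ofReal (C ^ 2) ∂μ := by
        refine setLIntegral_mono measurable_const fun u hu ↦ ?_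
        rw [← ofReal_norm, ← ENNReal.ofReal_pow (norm_nonneg _)]
        exact ENNReal.ofReal_le_ofReal (pow_le_pow_left₀ (norm_nonneg _) (hC u hu) 2)
    _ = ENNReal.ofReal (C ^ 2) * μ (closure 𝓕₀)⁻¹ := setLIntegral_const _ _
    _ < ⊤ := ENNReal.mul_lt_top ENNReal.ofReal_lt_top hK.inv.measure_lt_top

/-- `∫⁻ |1_{π⁻¹S} ′F|² = ∫⁻_{π⁻¹S} |′F|²`. [folklore] -/
theorem lintegral_primeLift_indicator_sq {S : Set Ball} (hS : MeasurableSet S) (F : Ball → ℂ) :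
    ∫⁻ g, ‖primeLift 1 (S.indicator F) g‖ₑ ^ 2 ∂μ = ∫⁻ g in orbitPre S, ‖primeLift 1 F g‖ₑ ^ 2 ∂μ := by
  rw [primeLift_indicator, ← lintegral_indicator (measurableSet_orbitPre hS)]
  refine lintegral_congr fun g ↦ ?_
  by_cases hg : g ∈ orbitPre S
  · simp [hg]
  · simp [hg]

/-- **Square-integrability of `1_S F` from the record** and `∫_{π⁻¹S} |′F|² dμ < ∞`. [folklore] -/
theorem memLp_indicator_of_record {c : ℝ≥0∞} (hc0 : c ≠ 0)
    (hR : ∀ f : Ball → ℂ, Measurable f →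
      ∫⁻ g, ‖primeLift 1 f g‖ₑ ^ 2 ∂μ = c * ∫⁻ z, ‖f z‖ₑ ^ 2 ∂ballVolume)
    {S : Set Ball} (hS : MeasurableSet S) {F : Ball → ℂ} (hF : Measurable F)
    (hfin : ∫⁻ g in orbitPre S, ‖primeLift 1 F g‖ₑ ^ 2 ∂μ < ⊤) :
    MemLp (S.indicator F) 2 ballVolume := by
  refine memLp_two_of_lintegral (hF.indicator hS).aestronglyMeasurable ?_
  have h1 := hR _ (hF.indicator hS)
  rw [lintegral_primeLift_indicator_sq μ hS] at h1
  exact ENNReal.lt_top_of_mul_ne_top_right (h1 ▸ hfin).ne hc0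

/-- **Unfolding + polarisation**: `∫_{π⁻¹S} liftPairing 1 F′ F dμ = c ∫_S conj F′ · F dv`.
[folklore] -/
theorem setIntegral_orbitPre_liftPairing {c : ℝ≥0∞} (hc0 : c ≠ 0) (hct : c ≠ ⊤)
    (hR : ∀ f : Ball → ℂ, Measurable f →
      ∫⁻ g, ‖primeLift 1 f g‖ₑ ^ 2 ∂μ = c * ∫⁻ z, ‖f z‖ₑ ^ 2 ∂ballVolume)
    {S : Set Ball} (hS : MeasurableSet S) {F F' : Ball → ℂ} (hF : Measurable F)
    (hF' : Measurable F') (hfin : ∫⁻ g in orbitPre S, ‖primeLift 1 F g‖ₑ ^ 2 ∂μ < ⊤)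
    (hfin' : ∫⁻ g in orbitPre S, ‖primeLift 1 F' g‖ₑ ^ 2 ∂μ < ⊤) :
    ∫ g in orbitPre S, liftPairing 1 F' F g ∂μ =
      (c.toReal : ℂ) * ∫ z in S, conj (F' z) * F z ∂ballVolume := by
  have key := integral_conj_mul_eq_of_sq (μ := μ) (ν := ballVolume) hct (primeLift 1)
    (primeLift_add_smul 1) (fun f hf ↦ (measurable_primeLift 1 hf).aestronglyMeasurable) hR
    (hF.indicator hS) (hF'.indicator hS) (memLp_indicator_of_record μ hc0 hR hS hF hfin)
    (memLp_indicator_of_record μ hc0 hR hS hF' hfin')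
  have hl : ∀ g, conj (primeLift 1 (S.indicator F') g) * primeLift 1 (S.indicator F) g =
      (orbitPre S).indicator (liftPairing 1 F' F) g := by
    intro g
    rw [primeLift_indicator, primeLift_indicator]
    by_cases hg : g ∈ orbitPre S
    · simp only [Set.indicator_of_mem hg, conj_primeLift_mul_primeLift]
    · simp [hg]
  have hr : ∀ z, conj (S.indicator F' z) * S.indicator F z =
      S.indicator (fun z ↦ conj (F' z) * F z) z := by
    intro z
    by_cases hz : z ∈ S
    · simp [hz]
    · simp [hz]
  simp_rw [hl, hr, integral_indicator (measurableSet_orbitPre hS), integral_indicator hS] at key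
  exact key

end Record

end BallForms

/-! ### §3 The descent for `Δ = ρ_𝔣(Γ)` -/

namespace UnitaryBallUniformisationDatum

open Literature.Geometry.Kaehler (MForm IsHolomorphicInCharts holFormsInCharts)
open Literature.NumberTheory.Transcendental
open Literature.AlgebraicGeometry.HodgeTheory (HodgeModel)
open Literature.AlgebraicGeometry.Motives (cintegral)
open scoped Manifold

variable {X₂ : Motives.SchemeOver ℂ} (D : UnitaryBallUniformisationDatum 2 X₂) (A : HodgeModel 2 X₂)
  (𝔣 : D.SylvesterFrame)

/-- Local freeness of `Δ = ρ_𝔣(Γ)` on the ball, in the form the fundamental-domain construction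
wants: every point has an open neighbourhood `V` with `δ V ∩ V = ∅` for `δ ≠ 1`.
[cite: Borel1969, Prop. 7.13] -/
theorem exists_isOpen_disjoint_smul (z : Ball) :
    ∃ V : Set Ball, IsOpen V ∧ z ∈ V ∧
      ∀ δ : D.ballImage 𝔣, δ ≠ 1 → Disjoint (δ • V) V := by
  obtain ⟨V, hVo, hzV, hV⟩ := D.exists_isOpen_forall_smul_mem_imp 𝔣 z
  refine ⟨V, hVo, hzV, fun δ hδ ↦ Set.disjoint_left.2 fun w hw hwV ↦ hδ ?_⟩
  obtain ⟨v, hv, rfl⟩ := Set.mem_smul_set.1 hw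
  obtain ⟨γ, -, hγ⟩ := Subgroup.mem_map.1 δ.2
  have h1 : γ = 1 := hV γ v hv (by rw [hγ, ← BallModel.subgroup_smul_def]; exact hwV)
  ext1
  rw [← hγ, h1, map_one, Subgroup.coe_one]

/-- **A measurable fundamental domain of `Δ = ρ_𝔣(Γ)` in the ball exists** (for any measure).
[folklore] -/
theorem exists_isFundamentalDomain_ball [Countable (D.ballImage 𝔣)] (ν : Measure Ball) :
    ∃ 𝓕D : Set Ball, MeasurableSet 𝓕D ∧ IsFundamentalDomain (D.ballImage 𝔣) 𝓕D ν := by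
  haveI : SecondCountableTopology Ball :=
    inferInstanceAs (SecondCountableTopology {z : Fin 2 → ℂ // nsq z < 1})
  obtain ⟨𝓕D, -, hm, h⟩ := DiscreteSubgroup.exists_subset_measurableSet_existsUnique
    (Γ := D.ballImage 𝔣) (K := (Set.univ : Set Ball)) MeasurableSet.univ
    (fun z ↦ ⟨1, Set.mem_univ _⟩) (fun z _ ↦ D.exists_isOpen_disjoint_smul 𝔣 z)
  exact ⟨𝓕D, hm, DiscreteSubgroup.isFundamentalDomain_of_existsUnique hm h ν⟩

/-- The automorphic form `F_α = ψ^* α` is continuous on the ball. [folklore] -/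
theorem continuous_holFormPullback₂ (α : holFormsInCharts A.model A.carrier 2) :
    Continuous (D.holFormPullback₂ A 𝔣 ⊤ α : Ball → ℂ) :=
  BallForms.continuous_of_mem_holomorphic (BallForms.mem_holFactorForms_iff.mp
    (D.holFormPullback₂ A 𝔣 ⊤ α).2).2

/-- `|′F_α|²` is left `Δ`-invariant. [folklore] -/
theorem enorm_primeLift_sq_mul_left (α : holFormsInCharts A.model A.carrier 2)
    {δ : U21} (hδ : δ ∈ D.ballImage 𝔣) (u : U21) :
    ‖BallForms.primeLift 1 (D.holFormPullback₂ A 𝔣 ⊤ α : Ball → ℂ) (δ * u)‖ₑ ^ 2 =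
      ‖BallForms.primeLift 1 (D.holFormPullback₂ A 𝔣 ⊤ α : Ball → ℂ) u‖ₑ ^ 2 := by
  have h := D.liftPairing_holAutForms_mul_left 𝔣 (D.holFormPullback₂ A 𝔣 ⊤ α)
    (D.holFormPullback₂ A 𝔣 ⊤ α) hδ u
  rw [← BallForms.ofReal_norm_primeLift_sq, ← BallForms.ofReal_norm_primeLift_sq] at h
  have h' : ‖BallForms.primeLift 1 (D.holFormPullback₂ A 𝔣 ⊤ α : Ball → ℂ) (δ * u)‖ ^ 2 =
      ‖BallForms.primeLift 1 (D.holFormPullback₂ A 𝔣 ⊤ α : Ball → ℂ) u‖ ^ 2 := by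
    exact_mod_cast h
  rw [← ofReal_norm, ← ofReal_norm, ← ENNReal.ofReal_pow (norm_nonneg _),
    ← ENNReal.ofReal_pow (norm_nonneg _), h']

variable [MeasurableSpace A.model] [BorelSpace A.model] [Fact (Module.finrank ℝ A.model = 4)]

/-- **The descent** (registry node N-D2, stage 2): Baily's record and the ball-side wedge formula
give the Petersson–wedge formula on `U(2,1)`, for `Δ = ρ_𝔣(Γ)` discrete and cocompact.
[folklore] -/
theorem PeterssonWedgeFormula_of [DiscreteTopology (D.ballImage 𝔣)]
    [CompactSpace (U21 ⧸ D.ballImage 𝔣)]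
    (o : (x : A.carrier) → Orientation ℝ (TangentSpace 𝓘(ℝ, A.model) x) (Fin 4))
    (μ : Measure U21) (hB : BallForms.Baily1973_10_3 μ) (hW : D.BallWedgeFormula A 𝔣 o) :
    D.PeterssonWedgeFormula A 𝔣 o μ := by
  intro ho hμ
  haveI : Countable (D.ballImage 𝔣) := DiscreteSubgroup.countable_of_discrete _
  obtain ⟨c₄, hc₄, hWF⟩ := hW ho
  obtain ⟨c, hc0, hct, hR⟩ := hB.lintegral_primeLift_sq μ
  obtain ⟨𝓕D, h𝓕Dm, h𝓕D⟩ := D.exists_isFundamentalDomain_ball 𝔣 ballVolume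
  have hnull : ∀ N : Set Ball, ballVolume N = 0 → μ (BallForms.orbitPre N) = 0 :=
    fun N hN ↦ BallForms.measure_orbitPre_null μ hR hN
  have h𝓕D' : IsFundamentalDomain (D.ballImage 𝔣) (BallForms.orbitPre 𝓕D) μ :=
    BallForms.isFundamentalDomain_orbitPre μ hnull h𝓕Dm h𝓕D
  refine ⟨(c.toReal : ℂ) * c₄, mul_ne_zero ?_ hc₄, fun 𝓕 _ h𝓕 α α' ↦ ?_⟩
  · exact_mod_cast ENNReal.toReal_ne_zero.2 ⟨hc0, hct⟩
  set F : D.holAutForms 𝔣 ⊤ (BallForms.canonicalCocycle ℂ 1) := D.holFormPullback₂ A 𝔣 ⊤ α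
  set F' : D.holAutForms 𝔣 ⊤ (BallForms.canonicalCocycle ℂ 1) := D.holFormPullback₂ A 𝔣 ⊤ α'
  have hfin : ∀ β : holFormsInCharts A.model A.carrier 2,
      ∫⁻ g in BallForms.orbitPre 𝓕D,
        ‖BallForms.primeLift 1 (D.holFormPullback₂ A 𝔣 ⊤ β : Ball → ℂ) g‖ₑ ^ 2 ∂μ < ⊤ :=
    fun β ↦ BallForms.setLIntegral_lt_top_of_invariant μ h𝓕D'
      (BallForms.continuous_primeLift 1 (D.continuous_holFormPullback₂ A 𝔣 β))
      (fun δ hδ u ↦ D.enorm_primeLift_sq_mul_left A 𝔣 β hδ u)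
  rw [h𝓕.setIntegral_eq h𝓕D' (f := BallForms.liftPairing 1 (F' : Ball → ℂ) (F : Ball → ℂ))
    fun δ u ↦ by
      rw [Subgroup.smul_def, smul_eq_mul]
      exact D.liftPairing_holAutForms_mul_left 𝔣 F' F δ.2 u,
    BallForms.setIntegral_orbitPre_liftPairing μ hc0 hct hR h𝓕Dm
      (D.continuous_holFormPullback₂ A 𝔣 α).measurable
      (D.continuous_holFormPullback₂ A 𝔣 α').measurable (hfin α) (hfin α'),
    hWF 𝓕D h𝓕Dm h𝓕D α α', mul_assoc]

end UnitaryBallUniformisationDatum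

end Literature.AlgebraicGeometry.ShimuraVarieties

end
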